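import Summits.FinalStateConjecture.FinalStateConjecture.Theorems.EIHFluxBalanceInertialRecessionChargeKinematicsPassage

/-!
# Route EIHFluxBalance — `InertialRecession`, line `old-light-leaves-the-cone`: charge kinematics,
# XX (general-N groundwork: cluster algebra, multi-partner budget, scale pigeonhole)

Helper file for the crux `stmt-FinalStateConjecture-10166`
(`Summit.FinalStateConjecture.FinalStateConjecture.Theses.EIHFluxBalance.InertialRecession`), second line
lead, endgame stub `stub_expandingChargeKinematics` (S4: abstract quasi-conserved window charges with the
slack-form window law and the single-hole identification ⇒ Cesàro velocities of the painted centres).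
THE ESCAPE SERIES: the endgame for `N = 3` (Case A all-pairs freezing is `ChargeKinematicsAllPairs*`;
Case B, the escape of a fast hole from a velocity-tight pair, is this series; the assembly is
`ChargeKinematicsThree`).

XX — GENERAL-N GROUNDWORK (MULTI-ESCAPE plan, Lines/old-light-leaves-the-cone-S4-plan-generalN.md): the
velocity increment of a member of a velocity-tight CLUSTER from the cluster bookkeeping
(`cluster_velocity_increment_le`), the multi-partner budget (`multi_partner_budget_le`), and the pigeonhole
over geometric scales (`exists_scale_without_height`, `disjoint_scale_windows`) with the gap clustering of
finitely many vectors (`exists_gap_scale`).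

Every statement is Mathlib-only real analysis over the stub's verbatim hypotheses ([folklore]); the abstract
charge `P` is arbitrary (adversarial), constrained only by the window law and the identification.
-/

set_option linter.dupNamespace false

noncomputable section

open Filter Set Metric Real
open scoped Topology

namespace Summit.FinalStateConjecture.FinalStateConjecture.Theorems.ChargeKinematics

open Literature.Geometry.Lorentzian

/-! ## Cluster algebra and the multi-partner budget -/

section ClusterAlgebra

open MeasureTheory intervalIntegral

/-- **Velocity increment of a member of a velocity-tight cluster from the cluster bookkeeping.** If at two
times the four components `W` of a window charge are `e`-close to the kinematic cluster charge
`(Σ_c M_cγ_c, Σ_c M_cγ_c v_c)` of a finite cluster `U ∋ a`, each component moved by at most `L`, and every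
internal relative velocity `v_c − v_a` (`c ∈ U`) has size `≤ β'` at both times, then (with `γ ≥ 1`,
`‖v‖ ≤ 1`, positive masses) `‖Δv_a‖ ≤ 4(L + e₁ + e₂)/(Σ_c M_c) + 2β'`: write
`p = E v_a + Σ_c M_cγ_c (v_c − v_a)`, `E = Σ_c M_cγ_c`. The pair case is `pair_velocity_increment_le`.
[folklore] -/
theorem cluster_velocity_increment_le {ι : Type*} (U : Finset ι) {a : ι} (ha : a ∈ U) {Mc : ι → ℝ}
    {v₁ v₂ : ι → E3} {γ₁ γ₂ : ι → ℝ} {W₁ W₂ : Fin 4 → ℝ} {L e₁ e₂ β' : ℝ}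
    (hM : ∀ c ∈ U, 0 < Mc c) (hγ₁ : ∀ c ∈ U, 1 ≤ γ₁ c) (hγ₂ : ∀ c ∈ U, 1 ≤ γ₂ c)
    (hv₁ : ∀ c ∈ U, ‖v₁ c‖ ≤ 1)
    (hr₁ : ∀ c ∈ U, ‖v₁ c - v₁ a‖ ≤ β') (hr₂ : ∀ c ∈ U, ‖v₂ c - v₂ a‖ ≤ β')
    (hid₁ : |W₁ 0 - ∑ c ∈ U, Mc c * γ₁ c| ≤ e₁ ∧
      ∀ k : Fin 3, |W₁ k.succ - ∑ c ∈ U, Mc c * γ₁ c * v₁ c k| ≤ e₁)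
    (hid₂ : |W₂ 0 - ∑ c ∈ U, Mc c * γ₂ c| ≤ e₂ ∧
      ∀ k : Fin 3, |W₂ k.succ - ∑ c ∈ U, Mc c * γ₂ c * v₂ c k| ≤ e₂)
    (hlaw : ∀ μ : Fin 4, |W₂ μ - W₁ μ| ≤ L) :
    ‖v₂ a - v₁ a‖ ≤ 4 * (L + e₁ + e₂) / (∑ c ∈ U, Mc c) + 2 * β' := by
  -- energies and momenta of the cluster
  set E₁ : ℝ := ∑ c ∈ U, Mc c * γ₁ c with hE₁
  set E₂ : ℝ := ∑ c ∈ U, Mc c * γ₂ c with hE₂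
  set p₁ : E3 := ∑ c ∈ U, (Mc c * γ₁ c) • v₁ c with hp₁
  set p₂ : E3 := ∑ c ∈ U, (Mc c * γ₂ c) • v₂ c with hp₂
  set Msum : ℝ := ∑ c ∈ U, Mc c with hMsum
  have hMM : 0 < Msum := Finset.sum_pos hM ⟨a, ha⟩
  have hE₁ge : Msum ≤ E₁ := Finset.sum_le_sum fun c hc ↦ by
    have := hM c hc; have := hγ₁ c hc; nlinarith
  have hE₂ge : Msum ≤ E₂ := Finset.sum_le_sum fun c hc ↦ by
    have := hM c hc; have := hγ₂ c hc; nlinarith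
  have hE₁pos : 0 < E₁ := hMM.trans_le hE₁ge
  have hE₂pos : 0 < E₂ := hMM.trans_le hE₂ge
  have hMγ₁ : ∀ c ∈ U, 0 ≤ Mc c * γ₁ c := fun c hc ↦ by
    have := hM c hc; have := hγ₁ c hc; positivity
  have hMγ₂ : ∀ c ∈ U, 0 ≤ Mc c * γ₂ c := fun c hc ↦ by
    have := hM c hc; have := hγ₂ c hc; positivity
  set I : ℝ := L + e₁ + e₂ with hI
  -- component bookkeeping
  have hE : |E₂ - E₁| ≤ I := by
    have h1 := hid₁.1; have h2 := hid₂.1; have h3 := hlaw 0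
    rw [abs_le] at h1 h2 h3 ⊢
    constructor <;> linarith
  have hpk : ∀ k : Fin 3, |p₂ k - p₁ k| ≤ I := by
    intro k
    have h1 := hid₁.2 k; have h2 := hid₂.2 k; have h3 := hlaw k.succ
    have e1 : p₁ k = ∑ c ∈ U, Mc c * γ₁ c * v₁ c k := by
      simp only [hp₁, WithLp.ofLp_sum, Finset.sum_apply, WithLp.ofLp_smul, Pi.smul_apply, smul_eq_mul]
    have e2 : p₂ k = ∑ c ∈ U, Mc c * γ₂ c * v₂ c k := by
      simp only [hp₂, WithLp.ofLp_sum, Finset.sum_apply, WithLp.ofLp_smul, Pi.smul_apply, smul_eq_mul]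
    rw [e1, e2]
    rw [abs_le] at h1 h2 h3 ⊢
    constructor <;> linarith
  have hp : ‖p₂ - p₁‖ ≤ 3 * I := by
    refine (norm_le_sum_abs_coord _).trans ?_
    calc ∑ k, |(p₂ - p₁) k| ≤ ∑ _k : Fin 3, I := Finset.sum_le_sum fun k _ ↦ by
            rw [PiLp.sub_apply]; exact hpk k
      _ = 3 * I := by simp [Finset.sum_const, nsmul_eq_mul]
  -- `‖p₁‖ ≤ E₁`
  have hp₁le : ‖p₁‖ ≤ E₁ := by
    refine (norm_sum_le _ _).trans (Finset.sum_le_sum fun c hc ↦ ?_)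
    rw [norm_smul, Real.norm_eq_abs, abs_of_nonneg (hMγ₁ c hc)]
    calc Mc c * γ₁ c * ‖v₁ c‖ ≤ Mc c * γ₁ c * 1 :=
          mul_le_mul_of_nonneg_left (hv₁ c hc) (hMγ₁ c hc)
      _ = Mc c * γ₁ c := mul_one _
  -- the decomposition `v_a = E⁻¹ (p - Σ M_c γ_c (v_c - v_a))`
  have hdec₁ : p₁ - ∑ c ∈ U, (Mc c * γ₁ c) • (v₁ c - v₁ a) = E₁ • v₁ a := by
    simp only [hp₁, hE₁, smul_sub, Finset.sum_sub_distrib, Finset.sum_smul]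
    abel
  have hdec₂ : p₂ - ∑ c ∈ U, (Mc c * γ₂ c) • (v₂ c - v₂ a) = E₂ • v₂ a := by
    simp only [hp₂, hE₂, smul_sub, Finset.sum_sub_distrib, Finset.sum_smul]
    abel
  have hva₁eq : v₁ a = E₁⁻¹ • (p₁ - ∑ c ∈ U, (Mc c * γ₁ c) • (v₁ c - v₁ a)) := by
    rw [hdec₁, smul_smul, inv_mul_cancel₀ hE₁pos.ne', one_smul]
  have hva₂eq : v₂ a = E₂⁻¹ • (p₂ - ∑ c ∈ U, (Mc c * γ₂ c) • (v₂ c - v₂ a)) := by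
    rw [hdec₂, smul_smul, inv_mul_cancel₀ hE₂pos.ne', one_smul]
  -- the momentum part
  have hmom : ‖E₂⁻¹ • p₂ - E₁⁻¹ • p₁‖ ≤ 4 * I / Msum := by
    have hsplit : E₂⁻¹ • p₂ - E₁⁻¹ • p₁ = E₂⁻¹ • (p₂ - p₁) + (E₂⁻¹ - E₁⁻¹) • p₁ := by
      rw [smul_sub, sub_smul]; abel
    rw [hsplit]
    refine (norm_add_le _ _).trans ?_
    rw [norm_smul, norm_smul, Real.norm_eq_abs, Real.norm_eq_abs, abs_of_pos (inv_pos.mpr hE₂pos)]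
    have h1 : E₂⁻¹ * ‖p₂ - p₁‖ ≤ E₂⁻¹ * (3 * I) := mul_le_mul_of_nonneg_left hp (inv_pos.mpr hE₂pos).le
    have hI0 : 0 ≤ I := (abs_nonneg _).trans hE
    have h2 : |E₂⁻¹ - E₁⁻¹| * ‖p₁‖ ≤ E₂⁻¹ * I := by
      have hinv : E₂⁻¹ - E₁⁻¹ = (E₁ - E₂) / (E₁ * E₂) := by field_simp
      rw [hinv, abs_div, abs_of_pos (mul_pos hE₁pos hE₂pos)]
      have hIE : |E₁ - E₂| ≤ I := by rw [abs_sub_comm]; exact hE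
      calc |E₁ - E₂| / (E₁ * E₂) * ‖p₁‖ ≤ I / (E₁ * E₂) * E₁ :=
            mul_le_mul (div_le_div_of_nonneg_right hIE (by positivity)) hp₁le (norm_nonneg _)
              (div_nonneg hI0 (by positivity))
        _ = E₂⁻¹ * I := by field_simp
    have h3 : E₂⁻¹ * (3 * I) + E₂⁻¹ * I = 4 * I / E₂ := by ring
    have h4 : 4 * I / E₂ ≤ 4 * I / Msum := div_le_div_of_nonneg_left (by positivity) hMM hE₂ge
    linarith
  -- the internal part
  have hint : ∀ {E : ℝ} {w : ι → E3} {γ : ι → ℝ}, 0 < E → (∀ c ∈ U, 0 ≤ Mc c * γ c) →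
      ∑ c ∈ U, Mc c * γ c ≤ E → (∀ c ∈ U, ‖w c‖ ≤ β') →
      ‖E⁻¹ • ∑ c ∈ U, (Mc c * γ c) • w c‖ ≤ β' := by
    intro E w γ hEpos hnn hle hw
    rw [norm_smul, Real.norm_eq_abs, abs_of_pos (inv_pos.mpr hEpos)]
    have hβ'0 : 0 ≤ β' := (norm_nonneg _).trans (hw a ha)
    have hsum : ‖∑ c ∈ U, (Mc c * γ c) • w c‖ ≤ (∑ c ∈ U, Mc c * γ c) * β' := by
      rw [Finset.sum_mul]
      refine (norm_sum_le _ _).trans (Finset.sum_le_sum fun c hc ↦ ?_)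
      rw [norm_smul, Real.norm_eq_abs, abs_of_nonneg (hnn c hc)]
      exact mul_le_mul_of_nonneg_left (hw c hc) (hnn c hc)
    calc E⁻¹ * ‖∑ c ∈ U, (Mc c * γ c) • w c‖ ≤ E⁻¹ * (E * β') := by
          refine mul_le_mul_of_nonneg_left (hsum.trans ?_) (inv_pos.mpr hEpos).le
          exact mul_le_mul_of_nonneg_right hle hβ'0
      _ = β' := by rw [← mul_assoc, inv_mul_cancel₀ hEpos.ne', one_mul]
  have hi₁ := hint (w := fun c ↦ v₁ c - v₁ a) hE₁pos hMγ₁ le_rfl hr₁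
  have hi₂ := hint (w := fun c ↦ v₂ c - v₂ a) hE₂pos hMγ₂ le_rfl hr₂
  -- assemble
  have hdecomp : v₂ a - v₁ a = (E₂⁻¹ • p₂ - E₁⁻¹ • p₁) -
      (E₂⁻¹ • (∑ c ∈ U, (Mc c * γ₂ c) • (v₂ c - v₂ a)) -
        E₁⁻¹ • (∑ c ∈ U, (Mc c * γ₁ c) • (v₁ c - v₁ a))) := by
    conv_lhs => rw [hva₂eq, hva₁eq]
    simp only [smul_sub]; abel
  rw [hdecomp]
  calc ‖(E₂⁻¹ • p₂ - E₁⁻¹ • p₁) - (E₂⁻¹ • (∑ c ∈ U, (Mc c * γ₂ c) • (v₂ c - v₂ a)) -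
        E₁⁻¹ • (∑ c ∈ U, (Mc c * γ₁ c) • (v₁ c - v₁ a)))‖
      ≤ ‖E₂⁻¹ • p₂ - E₁⁻¹ • p₁‖ + ‖E₂⁻¹ • (∑ c ∈ U, (Mc c * γ₂ c) • (v₂ c - v₂ a)) -
        E₁⁻¹ • (∑ c ∈ U, (Mc c * γ₁ c) • (v₁ c - v₁ a))‖ := norm_sub_le _ _
    _ ≤ 4 * I / Msum + (β' + β') :=
        add_le_add hmom ((norm_sub_le _ _).trans (add_le_add hi₂ hi₁))
    _ = 4 * (L + e₁ + e₂) / (∑ c ∈ U, Mc c) + 2 * β' := by simp only [hI, hMsum]; ring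

/-- **Multi-partner budget.** If on `[t₀, τ]` the radius `R ≥ 1` dominates `min((min_j d_j)/3, c₂ s)` for a
nonempty finite family of fly-by controlled distances — `d_j ≥ max(m₀, |φ_j|)`, `φ_j' ≥ g_j > 0` — then the
budget is at most the sum of the passage budgets. [folklore] -/
theorem multi_partner_budget_le {ι : Type*} (S : Finset ι) (hS : S.Nonempty) {R : ℝ → ℝ}
    {d φ φ' : ι → ℝ → ℝ} {g : ι → ℝ} {t₀ τ m₀ c₂ : ℝ} (ht₀ : 0 < t₀) (hτ : t₀ ≤ τ) (hm₀ : 0 < m₀)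
    (hc₂ : 0 < c₂) (hg : ∀ j ∈ S, 0 < g j) (hRcont : ContinuousOn R (Set.Icc t₀ τ))
    (hd : ∀ j ∈ S, Continuous (d j)) (hR1 : ∀ s ∈ Set.Icc t₀ τ, 1 ≤ R s)
    (hRge : ∀ s ∈ Set.Icc t₀ τ, min ((S.inf' hS fun j ↦ d j s) / 3) (c₂ * s) ≤ R s)
    (hfl : ∀ j ∈ S, ∀ s ∈ Set.Icc t₀ τ, max m₀ |φ j s| ≤ d j s)
    (hφ : ∀ j ∈ S, ∀ s, HasDerivAt (φ j) (φ' j s) s) (hφ' : ∀ j ∈ S, Continuous (φ' j))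
    (hmono : ∀ j ∈ S, ∀ s ∈ Set.Icc t₀ τ, g j ≤ φ' j s) :
    ∫ s in t₀..τ, (((R s) ^ 2)⁻¹ + ((R s) ^ (7 / 4 : ℝ))⁻¹) ≤
      ∑ j ∈ S, (9 * (2 * 2 * m₀ ^ (1 - 2 : ℝ) / ((2 - 1) * g j)) +
        (3 : ℝ) ^ (7 / 4 : ℝ) * (2 * (7 / 4) * m₀ ^ (1 - 7 / 4 : ℝ) / ((7 / 4 - 1) * g j)) +
        ((c₂ ^ 2 * t₀)⁻¹ + 4 / 3 * c₂ ^ (-(7 / 4) : ℝ) * t₀ ^ (-(3 / 4) : ℝ))) := by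
  -- clipped one-partner radii
  have hc : ∀ j ∈ S, Continuous (fun s ↦ max 1 (min (d j s / 3) (c₂ * s))) := fun j hj ↦
    continuous_const.max (((hd j hj).div_const 3).min (continuous_const.mul continuous_id))
  have hex : ∀ s ∈ Set.Icc t₀ τ, ∃ j ∈ S, max 1 (min (d j s / 3) (c₂ * s)) ≤ R s := by
    intro s hs
    obtain ⟨j, hj, hjeq⟩ := Finset.exists_mem_eq_inf' hS (fun j ↦ d j s)
    refine ⟨j, hj, max_le (hR1 s hs) ?_⟩
    have := hRge s hs
    rwa [hjeq] at this
  have hdom := integral_budget_le_sum S (Rp := fun j s ↦ max 1 (min (d j s / 3) (c₂ * s))) hτ hRcont hc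
    hR1 (fun j _ s ↦ le_max_left _ _) hex
  refine hdom.trans (Finset.sum_le_sum fun j hj ↦ ?_)
  refine passage_budget_le ht₀ hτ hm₀ hc₂ (hg j hj) (hc j hj).continuousOn (fun s _ ↦ le_max_left _ _)
    (fun s hs ↦ ?_) (hφ j hj) (hφ' j hj) (hmono j hj)
  have := hfl j hj s hs
  exact le_trans (min_le_min (by linarith) le_rfl) (le_max_right _ _)

end ClusterAlgebra

/-! ## The pigeonhole over scales -/

section ScaleGap

open MeasureTheory intervalIntegral

/-- **Pigeonhole over scales.** If a finite set of real "heights" has fewer than `K` elements, then among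
`K` pairwise disjoint sets (the scale windows) one contains no height. Used with the windows
`[θρ^j, θρ^{j+1})` to find a scale separating intra-cluster linkage heights from inter-cluster gaps.
[folklore] -/
theorem exists_scale_without_height {K : ℕ} (H : Finset ℝ) (hH : H.card < K) (I : Fin K → Set ℝ)
    (hdisj : ∀ j j', j ≠ j' → Disjoint (I j) (I j')) : ∃ j : Fin K, ∀ h ∈ H, h ∉ I j := by
  classical
  by_contra hcon
  push Not at hcon
  choose f hfH hfI using hcon
  have hinj : Function.Injective f := by
    intro j j' hjj'
    by_contra hne
    have h1 : f j ∈ I j := hfI j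
    have h2 : f j ∈ I j' := hjj' ▸ hfI j'
    exact Set.disjoint_left.mp (hdisj j j' hne) h1 h2
  have hcard : K ≤ H.card := by
    have := Finset.card_le_card_of_injOn f (s := (Finset.univ : Finset (Fin K))) (t := H)
      (fun j _ ↦ hfH j) (hinj.injOn)
    simpa using this
  omega

/-- The geometric scale windows `[θρ^j, θρ^{j+1})` are pairwise disjoint (`θ > 0`, `ρ > 1`). [folklore] -/
theorem disjoint_scale_windows {θ ρ : ℝ} (hθ : 0 < θ) (hρ : 1 < ρ) {K : ℕ} (j j' : Fin K) (hjj' : j ≠ j') :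
    Disjoint (Set.Ico (θ * ρ ^ (j : ℕ)) (θ * ρ ^ ((j : ℕ) + 1)))
      (Set.Ico (θ * ρ ^ (j' : ℕ)) (θ * ρ ^ ((j' : ℕ) + 1))) := by
  rw [Set.disjoint_left]
  intro x hx hx'
  have hmono : ∀ {m n : ℕ}, m ≤ n → θ * ρ ^ m ≤ θ * ρ ^ n := fun hmn ↦
    mul_le_mul_of_nonneg_left (pow_le_pow_right₀ hρ.le hmn) hθ.le
  rcases lt_or_gt_of_ne (Fin.val_ne_of_ne hjj') with h | h
  · have : θ * ρ ^ ((j : ℕ) + 1) ≤ θ * ρ ^ (j' : ℕ) := hmono h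
    linarith [hx.2, hx'.1]
  · have : θ * ρ ^ ((j' : ℕ) + 1) ≤ θ * ρ ^ (j : ℕ) := hmono h
    linarith [hx'.2, hx.1]

/-- **Gap clustering of finitely many vectors.** For a finite family of vectors `w` on `A`, a base scale
`θ > 0`, a ratio `ρ ≥ 2` and more scale windows than pairs (`A.card ^ 2 < K`), some scale
`T = θρ^j` (`j < K`) is a GAP: every pairwise distance is `< T` or `≥ ρT`. Consequently "distance `< T`"
is an equivalence relation on `A` (transitivity: `< 2T ≤ ρT` forces `< T`), whose classes are the
clusters at resolution `T` with inter-cluster gaps `≥ ρT`. [folklore] -/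
theorem exists_gap_scale {ι : Type*} [DecidableEq ι] (A : Finset ι) (w : ι → E3) {θ ρ : ℝ} (hθ : 0 < θ)
    (hρ : 2 ≤ ρ) {K : ℕ} (hK : A.card ^ 2 < K) :
    ∃ j : Fin K, (∀ i ∈ A, ∀ i' ∈ A, ‖w i - w i'‖ < θ * ρ ^ (j : ℕ) ∨ θ * ρ ^ ((j : ℕ) + 1) ≤ ‖w i - w i'‖) ∧
      (∀ i ∈ A, ∀ i' ∈ A, ∀ i'' ∈ A, ‖w i - w i'‖ < θ * ρ ^ (j : ℕ) → ‖w i' - w i''‖ < θ * ρ ^ (j : ℕ) →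
        ‖w i - w i''‖ < θ * ρ ^ (j : ℕ)) := by
  classical
  -- the set of pairwise distances
  set H : Finset ℝ := (A ×ˢ A).image fun p ↦ ‖w p.1 - w p.2‖ with hH
  have hHcard : H.card < K := by
    calc H.card ≤ (A ×ˢ A).card := Finset.card_image_le
      _ = A.card ^ 2 := by rw [Finset.card_product, sq]
      _ < K := hK
  obtain ⟨j, hj⟩ := exists_scale_without_height H hHcard
    (fun j : Fin K ↦ Set.Ico (θ * ρ ^ (j : ℕ)) (θ * ρ ^ ((j : ℕ) + 1)))
    (fun j j' hjj' ↦ disjoint_scale_windows hθ (by linarith) j j' hjj')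
  have hgap : ∀ i ∈ A, ∀ i' ∈ A, ‖w i - w i'‖ < θ * ρ ^ (j : ℕ) ∨ θ * ρ ^ ((j : ℕ) + 1) ≤ ‖w i - w i'‖ := by
    intro i hi i' hi'
    have hmem : ‖w i - w i'‖ ∈ H := Finset.mem_image.mpr ⟨(i, i'), Finset.mem_product.mpr ⟨hi, hi'⟩, rfl⟩
    have hnot := hj _ hmem
    simp only [Set.mem_Ico, not_and_or, not_le, not_lt] at hnot
    rcases hnot with h | h
    · exact Or.inl h
    · exact Or.inr h
  refine ⟨j, hgap, fun i hi i' hi' i'' hi'' h1 h2 ↦ ?_⟩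
  rcases hgap i hi i'' hi'' with h | h
  · exact h
  · exfalso
    have htri : ‖w i - w i''‖ ≤ ‖w i - w i'‖ + ‖w i' - w i''‖ := norm_sub_le_norm_sub_add_norm_sub _ _ _
    have hT : 0 < θ * ρ ^ (j : ℕ) := by positivity
    have hρT : θ * ρ ^ ((j : ℕ) + 1) = ρ * (θ * ρ ^ (j : ℕ)) := by ring
    rw [hρT] at h
    nlinarith

end ScaleGap

end Summit.FinalStateConjecture.FinalStateConjecture.Theorems.ChargeKinematics

namespace Summit.FinalStateConjecture.FinalStateConjecture.Theorems

/-- REGISTERED STUB `cluster_velocity_increment_le` of the crux item stmt-FinalStateConjecture-10166 (second line lead, line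
`old-light-leaves-the-cone`, S4 escape series): the registered one-line signature verbatim, discharged by
`ChargeKinematics.cluster_velocity_increment_le`. [folklore] -/
theorem cluster_velocity_increment_le : open Literature.Geometry.Lorentzian Filter Topology MeasureTheory intervalIntegral in ∀ {ι : Type*} (U : Finset ι) {a : ι} (ha : a ∈ U) {Mc : ι → ℝ} {v₁ v₂ : ι → E3} {γ₁ γ₂ : ι → ℝ} {W₁ W₂ : Fin 4 → ℝ} {L e₁ e₂ β' : ℝ} (hM : ∀ c ∈ U, 0 < Mc c) (hγ₁ : ∀ c ∈ U, 1 ≤ γ₁ c) (hγ₂ : ∀ c ∈ U, 1 ≤ γ₂ c) (hv₁ : ∀ c ∈ U, ‖v₁ c‖ ≤ 1) (hr₁ : ∀ c ∈ U, ‖v₁ c - v₁ a‖ ≤ β') (hr₂ : ∀ c ∈ U, ‖v₂ c - v₂ a‖ ≤ β') (hid₁ : |W₁ 0 - ∑ c ∈ U, Mc c * γ₁ c| ≤ e₁ ∧ ∀ k : Fin 3, |W₁ k.succ - ∑ c ∈ U, Mc c * γ₁ c * v₁ c k| ≤ e₁) (hid₂ : |W₂ 0 - ∑ c ∈ U, Mc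 c * γ₂ c| ≤ e₂ ∧ ∀ k : Fin 3, |W₂ k.succ - ∑ c ∈ U, Mc c * γ₂ c * v₂ c k| ≤ e₂) (hlaw : ∀ μ : Fin 4, |W₂ μ - W₁ μ| ≤ L), ‖v₂ a - v₁ a‖ ≤ 4 * (L + e₁ + e₂) / (∑ c ∈ U, Mc c) + 2 * β' :=
  @ChargeKinematics.cluster_velocity_increment_le

end Summit.FinalStateConjecture.FinalStateConjecture.Theorems

end
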